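import Literature.Computability.Cryptography.QuantumTuringMachinePrecision
import HarnessLib

/-!
# Positioned configurations of a quantum Turing machine (Bernstein–Vazirani 1997, Def. 3.2–3.4) and the projection onto the tree's head-relative model

Sibling file of `QuantumTuringMachine.lean` (prelude Q8: `QTM`, `QTM.Cfg`, `QTM.evolve`,
`QTM.IsWellFormed`, `QTM.stateAt`, `QTM.acceptProbAt`, `BQPQTMWith`). The tree's configurations
`QTM.Cfg = (state, Turing.Tape)` carry the tape RELATIVE TO THE HEAD, so they are
Bernstein–Vazirani's configurations (state, tape `ℤ → Σ`, head position; E. Bernstein,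
U. Vazirani, *Quantum complexity theory*, SIAM J. Comput. 26 (1997), Def. 3.2) modulo
translation, and `QTM.evolve` adds the amplitudes of translates (model caveat recorded in
`QuantumComplexity/QuantumTuringProofs.lean`, with the two-state example `RotationWalk`:
`576/625` in the tree versus `288/625` in BV's model). This file vendors BV's model itself, in
the cheapest faithful form — a *positioned configuration* is a tree configuration together with
the absolute head position, `QTM.PCfg M = M.Cfg × ℤ` (a bijection with BV's triples via
`T z = tape.nth (z - ξ)`) — and PROVES how the two models are related. No named fact is
introduced; nothing in Q8 is changed.

## Contents (all proved)

* `QTM.pevolveWith`, `QTM.pevolve` — BV's time evolution operator (Def. 3.2) on finitely supported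
  superpositions of positioned configurations (the formula of `QTM.evolve`, the position moving
  by `∓1`); `QTM.pinit`, `QTM.pstateAt`, `QTM.pacceptProbAt` (observation of the control state
  after exactly `t` steps, BV Def. 3.4 / Adleman–DeMarrais–Huang 1997 Def. 2.1),
  `QTM.PIsWellFormed` (BV Def. 3.3: the evolution preserves length).
* **Projection** (`QTM.mapDomain_fst_pevolveWith`, `QTM.mapDomain_fst_pevolve`,
  `QTM.mapDomain_fst_pstateAt`): forgetting positions, i.e. summing amplitudes over translates
  (`Finsupp.mapDomain Prod.fst`), intertwines the positioned evolution with the tree's: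
  `fst_* ∘ pevolve = evolve ∘ fst_*`, hence `M.stateAt x t = fst_* (M.pstateAt x t)`. This is the
  exact content of the model caveat: the tree's amplitude of a head-relative configuration is the
  sum of BV's amplitudes of its translates (so `QTM.acceptProbAt` is BV's acceptance probability
  plus interference terms between a run and its translates).
* **Translation covariance** (`QTM.pevolveWith_mapDomain_translate`).
* **BV well-formedness implies tree well-formedness** (`QTM.isWellFormed_of_pIsWellFormed`):
  if `pevolve` preserves length then so does `QTM.evolve`. Proof (a Gram-matrix argument in
  miniature): place `ψ` at position `0`; one positioned step is the left half of the tree's step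
  at position `-1` plus the right half at `+1` (`QTM.pevolveWith_mapDomain_place`), orthogonal
  pieces of total squared length `‖ψ‖²`; the tree's step is their sum, and the cross term
  `Re ⟪left, right⟫` vanishes since by covariance and polarisation
  (`QTM.re_finner_map_eq`) it equals `Re ⟪U(ψ@0), U(ψ@2)⟫ = Re ⟪ψ@0, ψ@2⟫ = 0`. (The converse —
  tree well-formedness implies BV well-formedness as soon as the tape alphabet has a non-blank
  symbol, by separating translates with a far-away marker cell — is not in this file.)
* `BQPQTMPosWith S`, `BQPQTMPos` — the positioned counterparts of `BQPQTMWith S`, `BQPQTM`: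
  Adleman–DeMarrais–Huang's `BQP_T` (Def. 2.1, fixed-time observation) for machines with
  amplitudes in `S`, i.e. the classes about which the printed theorems vendored as
  `Literature.Computability.QuantumComplexity.BQPQTM_eq_BQP` (S04) and
  `….BQPQTMWith_adhAmplitudes` (S05) are actually stated in the sources; `BQPQTMPosWith_mono`.
  No inclusion between `BQPQTMPosWith S` and `BQPQTMWith S` is claimed: the acceptance
  functionals differ (`RotationWalk`), and relating the classes is a simulation theorem.
* An `ℓ²` inner product `QTM.finner` on `α →₀ ℂ` complementing `sqNorm`/`l2Norm` of
  `QuantumTuringMachinePrecision.lean`: sesquilinearity, Hermitian symmetry, orthogonality of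
  disjointly supported vectors, invariance under injective relabelling, `‖v + w‖² = ‖v‖² + ‖w‖² +
  2 Re ⟪v, w⟫` (`QTM.sqNorm_add`) and real polarisation (`QTM.re_finner_map_eq`).

## Design choices

* `PCfg` is a product with the EXISTING `QTM.Cfg` rather than a new structure with a `pos`
  field, so that the projection is literally `Prod.fst` and every tree notion is reused; an
  in-place repair of Q8 (adding `pos : ℤ` to `QTM.Cfg`) would be isomorphic to this file.
* Thresholds, fixed-time observation and amplitude bookkeeping (`QTM.amplitudes`) of
  `BQPQTMPosWith` are those of `BQPQTMWith`, so that only the configuration space differs.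

## References

* E. Bernstein, U. Vazirani, *Quantum complexity theory*, SIAM J. Comput. 26 (1997) 1411–1473
  [BernsteinVaziraniSICOMP1997]: Def. 3.2 (QTM, configurations `(state, tape, head position)`,
  time evolution), Def. 3.3 (well-formed), Def. 3.4 (observation), §8 (`BQP`).
* L. M. Adleman, J. DeMarrais, M.-D. A. Huang, *Quantum computability*, SIAM J. Comput. 26
  (1997) 1524–1540 [AdlemanDeMarraisHuangSICOMP1997]: §2 (configurations as an orthonormal
  basis of `H`, well-formedness), Def. 2.1 (`BQP_T`, observation after exactly `f(|x|)` steps).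
-/

noncomputable section

namespace Literature.Computability.Cryptography

namespace QTM

open Turing Finsupp
open scoped BigOperators ComplexConjugate

/-! ### A Hermitian form on finitely supported superpositions -/

section Inner

variable {α β : Type*}

/-- The `ℓ²` inner product `⟪v, w⟫ = ∑_c conj (v c) · w c` of finitely supported complex
functions (conjugate-linear in the first variable), summed over the support of `v`
(Bernstein–Vazirani 1997, §2: superpositions live in `ℓ²` of the configurations). [cite: BernsteinVaziraniSICOMP1997, §2] -/
def finner (v w : α →₀ ℂ) : ℂ :=
  v.sum fun c a => conj a * w c

/-- `⟪v, w⟫` over any finite set containing the support of `v`. [folklore] -/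
theorem finner_eq_sum_of_subset {v : α →₀ ℂ} (w : α →₀ ℂ) {s : Finset α} (h : v.support ⊆ s) :
    finner v w = ∑ c ∈ s, conj (v c) * w c :=
  Finsupp.sum_of_support_subset v h _ (fun _ _ => by simp)

/-- Additivity of `⟪·, w⟫`. [folklore] -/
theorem finner_add_left (v₁ v₂ w : α →₀ ℂ) :
    finner (v₁ + v₂) w = finner v₁ w + finner v₂ w :=
  Finsupp.sum_add_index' (fun _ => by simp) (fun _ _ _ => by simp [add_mul])

/-- Additivity of `⟪v, ·⟫`. [folklore] -/
theorem finner_add_right (v w₁ w₂ : α →₀ ℂ) :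
    finner v (w₁ + w₂) = finner v w₁ + finner v w₂ := by
  unfold finner
  rw [← Finsupp.sum_add]
  exact Finsupp.sum_congr fun c _ => by rw [Finsupp.add_apply, mul_add]

/-- Hermitian symmetry `⟪v, w⟫ = conj ⟪w, v⟫`. [folklore] -/
theorem finner_conj_symm (v w : α →₀ ℂ) : finner v w = conj (finner w v) := by
  classical
  rw [finner_eq_sum_of_subset w (Finset.subset_union_left (s₂ := w.support)),
    finner_eq_sum_of_subset v (Finset.subset_union_right (s₁ := v.support)), map_sum]
  refine Finset.sum_congr rfl fun c _ => ?_
  rw [map_mul, Complex.conj_conj, mul_comm]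

/-- Real parts of `⟪v, w⟫` and `⟪w, v⟫` agree. [folklore] -/
theorem finner_re_comm (v w : α →₀ ℂ) : (finner v w).re = (finner w v).re := by
  rw [finner_conj_symm, Complex.conj_re]

/-- Vectors with disjoint supports are orthogonal. [folklore] -/
theorem finner_eq_zero_of_disjoint {v w : α →₀ ℂ} (h : Disjoint v.support w.support) :
    finner v w = 0 := by
  unfold finner Finsupp.sum
  refine Finset.sum_eq_zero fun c hc => ?_
  dsimp only
  rw [Finsupp.notMem_support_iff.1 (Finset.disjoint_left.1 h hc), mul_zero]

/-- An injective relabelling preserves inner products. [folklore] -/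
theorem finner_mapDomain_of_injective {f : α → β} (hf : Function.Injective f) (v w : α →₀ ℂ) :
    finner (Finsupp.mapDomain f v) (Finsupp.mapDomain f w) = finner v w := by
  unfold finner
  rw [Finsupp.sum_mapDomain_index_inj hf]
  exact Finsupp.sum_congr fun c _ => by rw [Finsupp.mapDomain_apply hf]

/-- `‖a + b‖² = ‖a‖² + ‖b‖² + 2 Re (conj a · b)` in `ℂ` (local copy of an elementary identity;
cf. `Complex.normSq_add`). [folklore] -/
private theorem norm_add_sq_complex (a b : ℂ) :
    ‖a + b‖ ^ 2 = ‖a‖ ^ 2 + ‖b‖ ^ 2 + 2 * (conj a * b).re := by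
  rw [← Complex.normSq_eq_norm_sq, ← Complex.normSq_eq_norm_sq, ← Complex.normSq_eq_norm_sq,
    Complex.normSq_add]
  congr 2
  rw [← Complex.conj_re (a * conj b), map_mul, Complex.conj_conj]

/-- The expansion `‖v + w‖² = ‖v‖² + ‖w‖² + 2 Re ⟪v, w⟫`. [folklore] -/
theorem sqNorm_add (v w : α →₀ ℂ) :
    sqNorm (v + w) = sqNorm v + sqNorm w + 2 * (finner v w).re := by
  classical
  have hv : v.support ⊆ v.support ∪ w.support := Finset.subset_union_left
  have hw : w.support ⊆ v.support ∪ w.support := Finset.subset_union_right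
  rw [sqNorm_eq_sum_of_subset (Finsupp.support_add.trans le_rfl), sqNorm_eq_sum_of_subset hv,
    sqNorm_eq_sum_of_subset hw, finner_eq_sum_of_subset w hv, Complex.re_sum, Finset.mul_sum,
    ← Finset.sum_add_distrib, ← Finset.sum_add_distrib]
  exact Finset.sum_congr rfl fun c _ => by rw [Finsupp.add_apply, norm_add_sq_complex]

/-- **Polarisation (real part)**: an additive map preserving squared norms preserves the real
parts of inner products. [folklore] -/
theorem re_finner_map_eq {U : (α →₀ ℂ) → (β →₀ ℂ)} (hadd : ∀ v w, U (v + w) = U v + U w)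
    (hiso : ∀ v, sqNorm (U v) = sqNorm v) (v w : α →₀ ℂ) :
    (finner (U v) (U w)).re = (finner v w).re := by
  have h1 := sqNorm_add (U v) (U w)
  have h2 := sqNorm_add v w
  rw [← hadd, hiso, hiso, hiso] at h1
  linarith

/-- Relabellings with disjoint ranges give disjointly supported vectors. [folklore] -/
theorem disjoint_support_mapDomain {f g : α → β} (v w : α →₀ ℂ)
    (h : ∀ a b, f a ≠ g b) :
    Disjoint (Finsupp.mapDomain f v).support (Finsupp.mapDomain g w).support := by
  classical
  refine Finset.disjoint_left.2 fun c hc hc' => ?_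
  obtain ⟨a, _, rfl⟩ := Finset.mem_image.1 (Finsupp.mapDomain_support hc)
  obtain ⟨b, _, hb⟩ := Finset.mem_image.1 (Finsupp.mapDomain_support hc')
  exact h a b hb.symm

end Inner

/-! ### Positioned configurations and their time evolution -/

variable (M : QTM)

/-- A *positioned configuration* of `M`: a configuration of the tree's model (control state and
head-relative tape) together with the absolute position `ξ ∈ ℤ` of the head. These are in
bijection with Bernstein–Vazirani's configurations (state, tape `ℤ → Γ` with finitely many
non-blank cells, head position; BV 1997, Def. 3.2) via `T z = tape.nth (z - ξ)`; the tree's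
`QTM.Cfg` is their quotient by translation (`Prod.fst`). [cite: BernsteinVaziraniSICOMP1997, Def. 3.2] -/
abbrev PCfg : Type := M.Cfg × ℤ

/-- Placing a head-relative configuration at absolute head position `k`. [folklore] -/
def place (k : ℤ) (c : M.Cfg) : M.PCfg := (c, k)

/-- `place k` is injective. [folklore] -/
theorem place_injective (k : ℤ) : Function.Injective (M.place k) :=
  fun _ _ h => congrArg Prod.fst h

/-- Distinct positions give distinct positioned configurations. [folklore] -/
theorem place_ne_place {k j : ℤ} (h : k ≠ j) (a b : M.Cfg) : M.place k a ≠ M.place j b :=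
  fun h' => h (congrArg Prod.snd h')

/-- Forgetting the position after placing is the identity. [folklore] -/
theorem mapDomain_fst_mapDomain_place (k : ℤ) (ψ : M.Cfg →₀ ℂ) :
    Finsupp.mapDomain Prod.fst (Finsupp.mapDomain (M.place k) ψ) = ψ := by
  rw [← Finsupp.mapDomain_comp]
  exact Finsupp.mapDomain_id

/-- The contribution of one positioned basis configuration `c` with amplitude `a` to one step of
the positioned evolution with kernel `δ'`: write `b`, enter `q'`, and move the head, the
absolute position changing by `∓1` (Bernstein–Vazirani 1997, Def. 3.2). [cite: BernsteinVaziraniSICOMP1997, Def. 3.2] -/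
def pstep (δ' : M.Kernel) (c : M.PCfg) (a : ℂ) : M.PCfg →₀ ℂ :=
  ∑ q' : M.Λ, ∑ b : M.Γ,
    ((a * δ' c.1.q c.1.tape.head q' b Dir.left) •
        Finsupp.single ((⟨q', (c.1.tape.write b).move Dir.left⟩ : M.Cfg), c.2 - 1) (1 : ℂ) +
      (a * δ' c.1.q c.1.tape.head q' b Dir.right) •
        Finsupp.single ((⟨q', (c.1.tape.write b).move Dir.right⟩ : M.Cfg), c.2 + 1) (1 : ℂ))

/-- The **positioned time evolution** with kernel `δ'`: Bernstein–Vazirani's time evolution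
operator (BV 1997, Def. 3.2) on finitely supported superpositions of positioned
configurations. [cite: BernsteinVaziraniSICOMP1997, Def. 3.2] -/
def pevolveWith (δ' : M.Kernel) (ψ : M.PCfg →₀ ℂ) : M.PCfg →₀ ℂ :=
  ψ.sum (M.pstep δ')

/-- The positioned time evolution of `M` (kernel `M.δ`). [cite: BernsteinVaziraniSICOMP1997, Def. 3.2] -/
def pevolve : (M.PCfg →₀ ℂ) → (M.PCfg →₀ ℂ) :=
  M.pevolveWith M.δ

/-- The initial positioned configuration on input `x`: the tree's `M.init x` with the head at
absolute position `0` (Bernstein–Vazirani 1997, Def. 3.2). [cite: BernsteinVaziraniSICOMP1997, Def. 3.2] -/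
def pinit (x : List Bool) : M.PCfg := (M.init x, 0)

/-- The positioned superposition after `t` steps on input `x`. [cite: BernsteinVaziraniSICOMP1997, Def. 3.2] -/
def pstateAt (x : List Bool) (t : ℕ) : M.PCfg →₀ ℂ :=
  M.pevolve^[t] (Finsupp.single (M.pinit x) 1)

/-- **Bernstein–Vazirani well-formedness** (BV 1997, Def. 3.3): the positioned time evolution
preserves `ℓ²` length on finitely supported superpositions. [cite: BernsteinVaziraniSICOMP1997, Def. 3.3] -/
def PIsWellFormed (M : QTM) : Prop :=
  ∀ ψ : M.PCfg →₀ ℂ, sqNorm (M.pevolve ψ) = sqNorm ψ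

/-- The probability of observing the accepting control state after exactly `t` steps on input
`x`, in the positioned model (Bernstein–Vazirani 1997, Def. 3.4; Adleman–DeMarrais–Huang 1997,
Def. 2.1 measures after exactly `f(|x|)` steps). [cite: AdlemanDeMarraisHuangSICOMP1997, Def. 2.1] -/
def pacceptProbAt (x : List Bool) (t : ℕ) : ℝ :=
  (M.pstateAt x t).sum fun c a => if c.1.q = M.accept then ‖a‖ ^ 2 else 0

/-! ### Linearity -/

/-- `pstep` vanishes on the zero amplitude. [folklore] -/
theorem pstep_zero (δ' : M.Kernel) (c : M.PCfg) : M.pstep δ' c 0 = 0 := by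
  simp [pstep]

/-- `pstep` is additive in the amplitude. [folklore] -/
theorem pstep_add (δ' : M.Kernel) (c : M.PCfg) (a₁ a₂ : ℂ) :
    M.pstep δ' c (a₁ + a₂) = M.pstep δ' c a₁ + M.pstep δ' c a₂ := by
  simp only [pstep, add_mul, add_smul, ← Finset.sum_add_distrib]
  exact Finset.sum_congr rfl fun _ _ => Finset.sum_congr rfl fun _ _ => by abel

/-- The positioned evolution is additive (it is linear; BV 1997, Def. 3.2). [cite: BernsteinVaziraniSICOMP1997, Def. 3.2] -/
theorem pevolveWith_add (δ' : M.Kernel) (ψ φ : M.PCfg →₀ ℂ) :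
    M.pevolveWith δ' (ψ + φ) = M.pevolveWith δ' ψ + M.pevolveWith δ' φ :=
  Finsupp.sum_add_index' (M.pstep_zero δ') (M.pstep_add δ')

/-! ### The two halves of a step and the projection onto the tree's model -/

/-- The part of the tree's evolution with kernel `δ'` that moves the head in direction `d`. [folklore] -/
def halfEvolve (δ' : M.Kernel) (d : Dir) (ψ : M.Cfg →₀ ℂ) : M.Cfg →₀ ℂ :=
  ψ.sum fun c a => ∑ q' : M.Λ, ∑ b : M.Γ,
    (a * δ' c.q c.tape.head q' b d) • Finsupp.single (⟨q', (c.tape.write b).move d⟩ : M.Cfg) (1 : ℂ)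

/-- The tree's evolution is the sum of its two halves. [folklore] -/
theorem evolveWith_eq_halfEvolve_add (δ' : M.Kernel) (ψ : M.Cfg →₀ ℂ) :
    M.evolveWith δ' ψ = M.halfEvolve δ' Dir.left ψ + M.halfEvolve δ' Dir.right ψ := by
  unfold evolveWith halfEvolve
  rw [← Finsupp.sum_add]
  exact Finsupp.sum_congr fun c _ => by simp only [Finset.sum_add_distrib]

/-- **One positioned step from position `k`**: the left half of the tree's step lands at
position `k - 1`, the right half at `k + 1`. [folklore] -/
theorem pevolveWith_mapDomain_place (δ' : M.Kernel) (k : ℤ) (ψ : M.Cfg →₀ ℂ) :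
    M.pevolveWith δ' (Finsupp.mapDomain (M.place k) ψ) =
      Finsupp.mapDomain (M.place (k - 1)) (M.halfEvolve δ' Dir.left ψ) +
        Finsupp.mapDomain (M.place (k + 1)) (M.halfEvolve δ' Dir.right ψ) := by
  unfold pevolveWith halfEvolve
  rw [Finsupp.sum_mapDomain_index (M.pstep_zero δ') (M.pstep_add δ'), Finsupp.mapDomain_sum,
    Finsupp.mapDomain_sum, ← Finsupp.sum_add]
  refine Finsupp.sum_congr fun c _ => ?_
  simp only [pstep, place, Finsupp.mapDomain_finsetSum, Finsupp.mapDomain_smul,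
    Finsupp.mapDomain_single, Finset.sum_add_distrib]

/-- **The tree's evolution is the projection of the positioned evolution**: forgetting head
positions (`Prod.fst`, which sums the amplitudes of all translates) intertwines `pevolveWith`
and `evolveWith`. This is the precise sense in which the tree's `QTM.Cfg`/`QTM.evolve` is
Bernstein–Vazirani's model modulo translation. [folklore] -/
theorem mapDomain_fst_pevolveWith (δ' : M.Kernel) (ψ : M.PCfg →₀ ℂ) :
    Finsupp.mapDomain Prod.fst (M.pevolveWith δ' ψ) =
      M.evolveWith δ' (Finsupp.mapDomain Prod.fst ψ) := by
  unfold pevolveWith evolveWith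
  rw [Finsupp.mapDomain_sum, Finsupp.sum_mapDomain_index]
  · refine Finsupp.sum_congr fun c _ => ?_
    simp only [pstep, Finsupp.mapDomain_finsetSum, Finsupp.mapDomain_add, Finsupp.mapDomain_smul,
      Finsupp.mapDomain_single]
  · intro c
    simp
  · intro c a₁ a₂
    simp only [add_mul, add_smul, ← Finset.sum_add_distrib]
    exact Finset.sum_congr rfl fun _ _ => Finset.sum_congr rfl fun _ _ => by abel

/-- The projection for the machine's own kernel: `fst_* ∘ pevolve = evolve ∘ fst_*`. [folklore] -/
theorem mapDomain_fst_pevolve (ψ : M.PCfg →₀ ℂ) :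
    Finsupp.mapDomain Prod.fst (M.pevolve ψ) = M.evolve (Finsupp.mapDomain Prod.fst ψ) :=
  M.mapDomain_fst_pevolveWith M.δ ψ

/-- The tree's superposition at time `t` is the projection of the positioned one: the
amplitude of a head-relative configuration is the SUM of the amplitudes of its translates. [folklore] -/
theorem mapDomain_fst_pstateAt (x : List Bool) (t : ℕ) :
    Finsupp.mapDomain Prod.fst (M.pstateAt x t) = M.stateAt x t := by
  induction t with
  | zero =>
    show Finsupp.mapDomain Prod.fst (Finsupp.single (M.pinit x) 1) = Finsupp.single (M.init x) 1
    rw [Finsupp.mapDomain_single]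
    rfl
  | succ t ih =>
    rw [show M.pstateAt x (t + 1) = M.pevolve (M.pstateAt x t) from
        Function.iterate_succ_apply' _ _ _,
      show M.stateAt x (t + 1) = M.evolve (M.stateAt x t) from Function.iterate_succ_apply' _ _ _,
      mapDomain_fst_pevolve, ih]

/-! ### Translation covariance -/

/-- Translating the head position by `k`. [folklore] -/
def translate (k : ℤ) (c : M.PCfg) : M.PCfg := (c.1, c.2 + k)

/-- Translation is injective. [folklore] -/
theorem translate_injective (k : ℤ) : Function.Injective (M.translate k) := by
  rintro ⟨c, i⟩ ⟨c', j⟩ h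
  simp only [translate, Prod.mk.injEq] at h
  obtain ⟨rfl, h⟩ := h
  have : i = j := by omega
  rw [this]

/-- **The positioned evolution commutes with translations** (Bernstein–Vazirani's time
evolution is translation invariant: the transition function sees only the state and the
scanned symbol). [folklore] -/
theorem pevolveWith_mapDomain_translate (δ' : M.Kernel) (k : ℤ) (ψ : M.PCfg →₀ ℂ) :
    M.pevolveWith δ' (Finsupp.mapDomain (M.translate k) ψ) =
      Finsupp.mapDomain (M.translate k) (M.pevolveWith δ' ψ) := by
  unfold pevolveWith
  rw [Finsupp.sum_mapDomain_index (M.pstep_zero δ') (M.pstep_add δ'), Finsupp.mapDomain_sum]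
  refine Finsupp.sum_congr fun c _ => ?_
  simp only [pstep, translate, Finsupp.mapDomain_finsetSum, Finsupp.mapDomain_add,
    Finsupp.mapDomain_smul, Finsupp.mapDomain_single]
  refine Finset.sum_congr rfl fun _ _ => Finset.sum_congr rfl fun _ _ => ?_
  rw [add_sub_right_comm, add_right_comm]

/-! ### Bernstein–Vazirani well-formedness implies well-formedness in the tree's model -/

/-- **A Bernstein–Vazirani well-formed transition table is well-formed in the tree's
(translation-quotient) model.** If the positioned evolution preserves length (BV 1997,
Def. 3.3), so does the tree's `QTM.evolve`. Proof: place `ψ` at position `0`; one positioned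
step splits into the left half at `-1` and the right half at `+1`, orthogonal pieces of total
squared length `‖ψ‖²`; the projection adds them, and the cross term `Re ⟪left, right⟫`
vanishes because, by translation covariance and polarisation, it equals
`Re ⟪U ψ@0, U ψ@2⟫ = Re ⟪ψ@0, ψ@2⟫ = 0`. (The converse holds as soon as the tape alphabet has a
non-blank symbol and is not proved here.) [folklore] -/
theorem isWellFormed_of_pIsWellFormed (h : M.PIsWellFormed) : M.IsWellFormed := by
  intro ψ
  have hadd : ∀ v w, M.pevolve (v + w) = M.pevolve v + M.pevolve w := M.pevolveWith_add M.δ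
  have hU : ∀ k : ℤ, M.pevolve (Finsupp.mapDomain (M.place k) ψ) =
      Finsupp.mapDomain (M.place (k - 1)) (M.halfEvolve M.δ Dir.left ψ) +
        Finsupp.mapDomain (M.place (k + 1)) (M.halfEvolve M.δ Dir.right ψ) :=
    fun k => M.pevolveWith_mapDomain_place M.δ k ψ
  set A := M.halfEvolve M.δ Dir.left ψ with hA
  set B := M.halfEvolve M.δ Dir.right ψ with hB
  have hdisj : ∀ {k j : ℤ}, k ≠ j → ∀ v w : M.Cfg →₀ ℂ,
      Disjoint (Finsupp.mapDomain (M.place k) v).support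
        (Finsupp.mapDomain (M.place j) w).support :=
    fun hkj v w => disjoint_support_mapDomain v w (M.place_ne_place hkj)
  -- total length: ‖A‖² + ‖B‖² = ‖ψ‖²
  have hlen : sqNorm A + sqNorm B = sqNorm ψ := by
    have h0 := h (Finsupp.mapDomain (M.place 0) ψ)
    rw [sqNorm_mapDomain_of_injective (M.place_injective 0), hU 0, sqNorm_add,
      finner_eq_zero_of_disjoint (hdisj (by norm_num) _ _),
      sqNorm_mapDomain_of_injective (M.place_injective _),
      sqNorm_mapDomain_of_injective (M.place_injective _)] at h0
    simpa using h0
  -- cross term: Re ⟪B, A⟫ = 0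
  have hcross : (finner B A).re = 0 := by
    have h02 := re_finner_map_eq hadd h (Finsupp.mapDomain (M.place 0) ψ)
      (Finsupp.mapDomain (M.place 2) ψ)
    rw [finner_eq_zero_of_disjoint (hdisj (by norm_num) _ _), hU 0, hU 2,
      show (0 : ℤ) - 1 = -1 by norm_num, show (0 : ℤ) + 1 = 1 by norm_num,
      show (2 : ℤ) - 1 = 1 by norm_num, show (2 : ℤ) + 1 = 3 by norm_num,
      finner_add_left, finner_add_right, finner_add_right,
      finner_eq_zero_of_disjoint (hdisj (show (-1 : ℤ) ≠ 1 by norm_num) A A),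
      finner_eq_zero_of_disjoint (hdisj (show (-1 : ℤ) ≠ 3 by norm_num) A B),
      finner_eq_zero_of_disjoint (hdisj (show (1 : ℤ) ≠ 3 by norm_num) B B),
      finner_mapDomain_of_injective (M.place_injective 1)] at h02
    simpa using h02
  show M.normSq (M.evolve ψ) = M.normSq ψ
  rw [normSq_eq_sqNorm, normSq_eq_sqNorm, evolve_eq_evolveWith, evolveWith_eq_halfEvolve_add,
    ← hA, ← hB, sqNorm_add, finner_re_comm, hcross, ← hlen]
  ring

/-! ### Acceptance probabilities in the positioned model -/

/-- Positioned superpositions of a BV-well-formed machine stay normalised. [cite: BernsteinVaziraniSICOMP1997, Def. 3.3] -/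
theorem PIsWellFormed.sqNorm_pstateAt (h : M.PIsWellFormed) (x : List Bool) (t : ℕ) :
    sqNorm (M.pstateAt x t) = 1 := by
  induction t with
  | zero => simp [pstateAt]
  | succ t ih =>
    rw [show M.pstateAt x (t + 1) = M.pevolve (M.pstateAt x t) from
        Function.iterate_succ_apply' _ _ _, h, ih]

/-- Positioned acceptance probabilities are nonnegative. [folklore] -/
theorem pacceptProbAt_nonneg (x : List Bool) (t : ℕ) : 0 ≤ M.pacceptProbAt x t :=
  Finset.sum_nonneg fun _ _ => by positivity

/-- Positioned acceptance probabilities are at most the squared length of the superposition. [folklore] -/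
theorem pacceptProbAt_le_sqNorm (x : List Bool) (t : ℕ) :
    M.pacceptProbAt x t ≤ sqNorm (M.pstateAt x t) := by
  unfold pacceptProbAt sqNorm Finsupp.sum
  refine Finset.sum_le_sum fun c _ => ?_
  dsimp only
  split_ifs
  · exact le_rfl
  · positivity

/-- For a BV-well-formed machine, positioned acceptance probabilities are at most `1`
(Bernstein–Vazirani 1997, remark after Def. 3.4). [cite: BernsteinVaziraniSICOMP1997, Def. 3.4] -/
theorem PIsWellFormed.pacceptProbAt_le_one (h : M.PIsWellFormed) (x : List Bool) (t : ℕ) :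
    M.pacceptProbAt x t ≤ 1 :=
  (M.pacceptProbAt_le_sqNorm x t).trans (h.sqNorm_pstateAt M x t).le

end QTM

/-! ### `BQP` via positioned quantum Turing machines -/

/-- `BQPQTMPosWith S`: the languages decided with thresholds `2/3`, `1/3` by a
Bernstein–Vazirani well-formed QTM (`QTM.PIsWellFormed`, BV 1997 Def. 3.3) with amplitudes in
`S`, observing the control state after exactly `p(|x|)` steps in the POSITIONED model
(`QTM.pacceptProbAt`) — the class `BQP_T` of Adleman–DeMarrais–Huang 1997, Def. 2.1, for
`T` = machines with amplitudes in `S` (there with strict thresholds `> 2/3`). This is the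
positioned counterpart of the tree's `BQPQTMWith S`, which measures the translation-quotient
superposition `QTM.stateAt = fst_* QTM.pstateAt` (`QTM.mapDomain_fst_pstateAt`). [cite: AdlemanDeMarraisHuangSICOMP1997, Def. 2.1] -/
def BQPQTMPosWith (S : Set ℂ) : Set (Language Bool) :=
  {L | ∃ (M : QTM) (p : Polynomial ℕ), M.PIsWellFormed ∧ M.amplitudes ⊆ S ∧
    ∀ x : List Bool, (x ∈ L → (2 / 3 : ℝ) ≤ M.pacceptProbAt x (p.eval x.length)) ∧
      (x ∉ L → M.pacceptProbAt x (p.eval x.length) ≤ (1 / 3 : ℝ))}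

/-- `BQPQTMPos`: Bernstein–Vazirani's `BQP` — `BQPQTMPosWith` for the polynomial-time computable
amplitudes (BV 1997, Def. 3.2 and §8; fixed-time observation of the control state as in
Adleman–DeMarrais–Huang 1997, Def. 2.1). [cite: BernsteinVaziraniSICOMP1997, §8] -/
def BQPQTMPos : Set (Language Bool) :=
  BQPQTMPosWith polyTimeComputableComplex

/-- `BQPQTMPosWith` is monotone in the amplitude set. [folklore] -/
theorem BQPQTMPosWith_mono {S S' : Set ℂ} (h : S ⊆ S') : BQPQTMPosWith S ⊆ BQPQTMPosWith S' := by
  rintro L ⟨M, p, hwf, hamp, hL⟩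
  exact ⟨M, p, hwf, hamp.trans h, hL⟩

end Literature.Computability.Cryptography
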